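import Literature.NumberTheory.LFunctions.Zhang2022.Section10Certificate

/-!
# Zhang (2022) Part II (§§7–12: Prop. 7.1, Lemma 8.1, (8.23)–(8.24), §§9–12): the parameter / constraint layer, typed

Trunk T-ANT (NumberTheory/LFunctions). Y. Zhang, *Discrete mean estimates and the Landau–Siegel
zero*, arXiv:2211.02515v1 (2022) [Zhang2022LandauSiegel] — an unrefereed manuscript under
adjudication (cell pub-zhang: audit + repair census of arXiv:2211.02515; **no claim about
Landau–Siegel**). **Nothing in this file asserts or denies its Theorems 1–2, its Propositions
2.1–2.6, 7.1, or any of its analytic lemmas (5.5–5.8, 8.1–8.4, 10.1–10.2, 11.1–11.2, 12.1–12.3).**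
It records, as DATA, the design parameters that Part II of the manuscript (§§7–12: the discrete
approximation Prop. 7.1, Lemma 8.1, the evaluations (8.23)/(9.7)/(10.17)/(12.9) and the printed
numerical inequalities (8.24), (9.8), §10) reads, and, as a `Prop`, the conjunction `AdmissibleII` of
the exponent / support inequalities those sections actually use — the Lean face of the cell's
`constraints/part2.json` (schema `pub-zhang/CONSTRAINTS/1`, unit b2b-zhang-dep-2; row ids quoted in
the comments), companion of `PartIIIConstraints` (dep-3) and `ExponentLayer` (sweep-2).

Exponents are powers of `𝓛 = log D` (`P = exp 𝓛^{kP}`, `T = exp 𝓛^{kT}`, `t₀ = 𝓛^{k0}`, …),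
mollifier lengths are powers of `P`, circle radii / shifts are multiples of `α = π/log P`.

The only theorems are elementary arithmetic on printed literals and re-packagings of the cell's
certificates:
* `PartIIDesign.printedII_admissible`: the PRINTED design satisfies every inventoried Part II row
  (`739 > 3·68 + 57·9`, `123 − 45 > 77`, `1 < 1.1 < 9`, `5 ± 3 ∈ [1, 10]`, `0.5 + 0.498 < 1`, …):
  the exponent bookkeeping of §§7–12 is internally consistent AS PRINTED;
* `PartIIDesign.admissible_withA_iff`: with every other parameter as printed, Part II's rows
  constrain the (A)-exponent only through `α₂ = 𝓛⁻¹⁵ ≥ 𝓛^{-A}` (Lemma 5.8) and `1 − ρ̃ = O(𝓛^{-A})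
  < 5α` (Lemma 5.5 inside Lemma 8.4): admissible iff `15 ≤ A` — Part II does not bind `A = 2022`
  (the binding rows are Part I's, `ExponentLayer.admissibleA_iff : … ↔ 2000 < A`);
* `PartIIDesign.printedII_radius102_violated`: the one row violated as printed (the circle
  `|s| = 10α` of Lemma 10.2 leaves Lemma 5.8's annulus `|s − 1| ≤ 10α` by `3α`; immaterial —
  cell errata E-II-g20-2);
* `numericClosingPartII_except824`, `not_numericClosingPartII`: of the printed numerical closing
  conditions that Part II produces — (8.24), (9.8), the three inequalities of §10 with Prop. 2.4's
  `|𝔡′ + 𝔡| > 5`, and (2.33)'s `C₂₃₃ < 3000` whose main terms are Lemma 10.1/10.2's — every one is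
  certified TRUE except (8.24), which is certified FALSE (`Section8Certificate.not_ineq824`:
  `𝔠₁ = 7.05010…` vs `< 6.9955`); hence the manuscript's Part II deliverable, read as the
  implication "admissible design ⇒ numerical closing conditions", fails at the printed design
  (`not_claimedNumericFace_printedII`). This is the cell's
  GAP restated at the level of this layer; it is arithmetic on certified constants, not analysis.

What is deliberately NOT here: any Dirichlet series, discrete mean, contour or `o(·)`; the
asymptotic formulae (8.23), (9.7), (10.17), (12.9) themselves; the Part I rows consumed by Part II
(Lemmas 5.5–5.8, Prop. 2.1 — cell seat dep-1; the consumer-side requirements ARE rows here: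
`xPsi2 > 3w + 57kP`, `k52 − 5kP > kPfrak`, `ka2 ≤ A0`, …); the Part III layer (dep-3).
-/

noncomputable section

open Complex Real ComplexConjugate

namespace Literature.NumberTheory.LFunctions.Zhang2022

/-- The design parameters read or constrained by Part II (§§7–12) of the manuscript. Field ↔
display (cell row ids of `constraints/part2.json` in brackets): `A0` (A); `kP` (2.6); `w` the
prime window `p ∼ P` exponent 68; `kPfrak` (2.9) (`𝔓 ≍ P²𝓛^{-kPfrak}`); `k1, k0` (2.8); `k2`
(2.15); `xPsi2` Prop. 2.1; `keps` (`ε = exp(−c𝓛^{keps})`, §4); `kg` (4.1) (`g` scale `𝓛^{15}`);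
`kg1` (`ω₁`, `𝓛^{30}`); `kv` (`|v| ≤ 𝓛^{20}` in `E₁, E₂`); `k52` Lemma 5.2 (`𝓛^{-123}`); `k56`
Lemma 5.6 (`exp(−𝓛^{9/2})`); `zfrW, zfrH` Lemma 5.5's box `σ > 1 − zfrW·𝓛⁻¹, |t| < zfrH·D`;
`r58lo, r58hi, ka2` Lemma 5.8 (`α ≤ |s−1| ≤ 10α`, `α₂ = 𝓛^{-15}`); `kT` §6 (`T = exp 𝓛^{kT}`);
`gS` the support `n < PT^{-gS}` of (7.2); `kE` the `𝓛²` in `E(a₁,a₂)` of Prop. 7.1; `ka1` the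
(undefined in the text) `α₁ = 𝓛^{-ka1}`, cell reading `α log T` [II-7.10a]; `b6, b7` (2.22) and
`bmax = 3` = `max_j |β_j|/α` (2.13), in units of `α`; `th1, th2, th3` (2.21), `gT2` the `T^{-10}` in
`P₂`; `th14` the split (12.1); `z0, z1, z2, slope` the tent `f̃` (2.28); `dJ` (2.30); `cL, cH` the
rectangle `Re s = −cL·𝓛⁻¹, |t| ≤ D^{cH}` of Lemmas 8.2/8.4/10.1/10.2; `rad` the circle `|s| = 5α`,
`rad2` the circle `|s| = 10α` of Lemma 10.2; `k82, sig83, k83, k84` the error exponents / half-plane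
of Lemmas 8.2–8.4; `kff` (`𝔣(P^z/m) = 𝔣𝔣(z) + O(𝓛^{-8})`); `k105` (10.5)/(10.11); `keta`
(`η± = exp(±𝓛^{-10})`, §11); `k113` (11.3); `kE2` Lemma 11.2; `k126` the window bound of §12.
[cite: Zhang2022LandauSiegel, §2 (2.6)–(2.30), §§4–8, §§10–12] -/
structure PartIIDesign where
  /-- (A): `L(1,χ) < 𝓛^{-A0}` -/
  A0 : ℝ
  /-- (2.6): `P = exp(𝓛^{kP})` -/
  kP : ℝ
  /-- `p ∼ P`: `P < p < P(1 + 𝓛^{-w})` -/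
  w : ℝ
  /-- (2.9): `𝔓 = (1+o(1))P²𝓛^{-kPfrak}` -/
  kPfrak : ℝ
  /-- (2.8): `𝓛₁ = 𝓛^{k1}` -/
  k1 : ℝ
  /-- (2.8): `t₀ = 𝓛^{k0}` -/
  k0 : ℝ
  /-- (2.15): `𝓛₂ = 𝓛^{k2}` -/
  k2 : ℝ
  /-- Prop. 2.1: `#Ψ₂ ≪ 𝔓𝓛^{-xPsi2}` -/
  xPsi2 : ℝ
  /-- §4: `ε = exp(−c𝓛^{keps})` -/
  keps : ℝ
  /-- (4.1): cutoff scale `𝓛^{kg}` of `g` -/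
  kg : ℝ
  /-- `ω₁(w) = exp(w²/(4𝓛^{kg1}))` -/
  kg1 : ℝ
  /-- `|v| ≤ 𝓛^{kv}` in `E₁` (Lemma 6.1), `E₂` (Lemma 11.2) -/
  kv : ℝ
  /-- Lemma 5.2: error `𝓛^{-k52}` -/
  k52 : ℝ
  /-- Lemma 5.6: saving `exp(−𝓛^{k56})` -/
  k56 : ℝ
  /-- Lemma 5.5: zero-free for `σ > 1 − zfrW·𝓛⁻¹` -/
  zfrW : ℝ
  /-- Lemma 5.5: … and `|t| < zfrH·D` -/
  zfrH : ℝ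
  /-- Lemma 5.8: `r58lo·α ≤ |s − 1|` -/
  r58lo : ℝ
  /-- Lemma 5.8: `|s − 1| ≤ r58hi·α` -/
  r58hi : ℝ
  /-- Lemma 5.8: `α₂ = 𝓛^{-ka2}` -/
  ka2 : ℝ
  /-- §6: `T = exp(𝓛^{kT})` -/
  kT : ℝ
  /-- (7.2): `a(n) = 0` for `n ≥ PT^{-gS}` -/
  gS : ℝ
  /-- Prop. 7.1: `E(a₁,a₂) = 𝔓𝓛^{kE} Σ_d Σ_r Σ_j |S_j|` -/
  kE : ℝ
  /-- `α₁ = 𝓛^{-ka1}` (undefined in the text; cell reading `α₁ = α log T`) -/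
  ka1 : ℝ
  /-- (2.22): `β₆ = b6·iα` -/
  b6 : ℝ
  /-- (2.22): `β₇ = b7·iα` -/
  b7 : ℝ
  /-- (2.13): `max_j |β_j| = bmax·α(1 + O(c′α𝓛))` -/
  bmax : ℝ
  /-- (2.21): `P₁ = P^{th1}` -/
  th1 : ℝ
  /-- (2.21): `P₂ = P^{th2}T^{-gT2}` -/
  th2 : ℝ
  /-- (2.21): `P₃ = P^{th3}` -/
  th3 : ℝ
  /-- (2.21): the `T^{-gT2}` in `P₂` -/
  gT2 : ℝ
  /-- (12.1): split of `H₁₁` at `P^{th14}` -/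
  th14 : ℝ
  /-- (2.28): tent left end -/
  z0 : ℝ
  /-- (2.28): tent peak -/
  z1 : ℝ
  /-- (2.28): tent right end -/
  z2 : ℝ
  /-- (2.28): tent slope -/
  slope : ℝ
  /-- (2.30): the shift `+0.004` in `J₂` -/
  dJ : ℝ
  /-- Lemmas 8.2/8.4/10.1/10.2: left edge `Re s = −cL·𝓛⁻¹` -/
  cL : ℝ
  /-- …: horizontal edges `|t| = D^{cH}` -/
  cH : ℝ
  /-- Lemmas 8.2/8.4/10.1, 12.1–12.3: residue circle `|s| = rad·α` -/
  rad : ℝ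
  /-- Lemma 10.2: second circle `|s| = rad2·α` -/
  rad2 : ℝ
  /-- Lemma 8.2: error `O(𝓛^{-k82})` -/
  k82 : ℝ
  /-- Lemma 8.3: half-plane `σ > sig83` -/
  sig83 : ℝ
  /-- Lemma 8.3: `𝔲_j = Π(d,r) + O(𝓛^{-k83})` for `|s − 1| ≤ 5α` -/
  k83 : ℝ
  /-- Lemma 8.4: error `O(𝓛^{-k84})` -/
  k84 : ℝ
  /-- `𝔣_{jμ}(P^z/m) = 𝔣𝔣_{jμ}(z) + O(𝓛^{-kff})` -/
  kff : ℝ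
  /-- (10.5), (10.11): window terms `≪ 𝓛^{-k105}` -/
  k105 : ℝ
  /-- §11: `η± = exp(±𝓛^{-keta})` -/
  keta : ℝ
  /-- (11.3): `≪ 𝓛^{-k113}` on the windows -/
  k113 : ℝ
  /-- Lemma 11.2: `E₂ = 𝓛^{-kE2}∫…` -/
  kE2 : ℝ
  /-- §12: window coefficients `≪ 𝓛^{-k126}` -/
  k126 : ℝ

namespace PartIIDesign

/-- The PRINTED design of arXiv:2211.02515v1 (with the cell reading `ka1 = kP − kT = 7.9` for the
undefined `α₁`). [cite: Zhang2022LandauSiegel, §2, §4, §§5–8, §§10–12] -/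
def printedII : PartIIDesign where
  A0 := 2022
  kP := 9
  w := 68
  kPfrak := 77
  k1 := 405
  k0 := 519
  k2 := 400
  xPsi2 := 739
  keps := 10
  kg := 15
  kg1 := 30
  kv := 20
  k52 := 123
  k56 := 9 / 2
  zfrW := 2
  zfrH := 2
  r58lo := 1
  r58hi := 10
  ka2 := 15
  kT := 1.1
  gS := 2
  kE := 2
  ka1 := 7.9
  b6 := 3 / 2
  b7 := 5 / 2
  bmax := 3
  th1 := 0.504
  th2 := 0.5
  th3 := 0.498
  gT2 := 10
  th14 := 1 / 2
  z0 := 0.5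
  z1 := 0.502
  z2 := 0.504
  slope := 500
  dJ := 0.004
  cL := 1
  cH := 1
  rad := 5
  rad2 := 10
  k82 := 6
  sig83 := 9 / 10
  k83 := 8
  k84 := 6
  kff := 8
  k105 := 7
  keta := 10
  k113 := 10
  kE2 := 68
  k126 := 10

/-- The two rows through which the (A)-exponent enters Part II: `𝓛^{-A} ≤ α₂` inside Lemma 5.8
[X-II.L5.8a] and `1 − ρ̃ = O(𝓛^{-A}) < 5α`, i.e. the exceptional zero lies inside the residue
circle of Lemma 8.4 [II-L8.4a, X-II.L5.5a]. [cite: Zhang2022LandauSiegel, Lemma 5.5, Lemma 5.8, Lemma 8.4] -/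
def ABinding (p : PartIIDesign) : Prop :=
  p.ka2 ≤ p.A0 ∧ p.kP < p.A0

/-- Rows of §7 (Prop. 7.1) and the Part-I exponents it consumes [II-7.02a … II-7.20a, X-II.7.05a,
X-II.2.09a, X-II.eps.a, X-II.7.14a]: support `gS > 0`; Gaussian range (7.4) `kP ≤ k2`; tail
`m ≥ P²` and the `ε`-mechanism; `𝔓`'s exponent; (7.5) via Prop. 2.1 (Hölder form of the cell,
`xPsi2 > 3w + 57kP = 717`, cf. `ExponentLayer.AdmissibleA`); (7.10)'s `O(α₁)`/`O(α𝓛)` inside `E`;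
(7.13)–(7.15): `th1 < 1`, `1 < kT` (so `R^{1/2}P^{3/2} ≤ P²T^{-1} ≤ P²D^{-c}`); (7.14) via Lemma 5.6
(`k56 > 1`); (7.20): `c′`-corrections `O(α𝓛) ⊂ E` (`1 ≤ kE`) and Lemma 5.4(ii)'s range `bmax < r58hi`.
[cite: Zhang2022LandauSiegel, §7] -/
def SectionSeven (p : PartIIDesign) : Prop :=
  0 < p.gS ∧ p.kP ≤ p.k2 ∧ p.keps ≤ p.kP + p.kT ∧ p.keps ≤ 2 * (p.k1 - p.k2) ∧
  p.kPfrak = p.w + p.kP ∧ 3 * p.w + 57 * p.kP < p.xPsi2 ∧ 0 < p.kT ∧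
  1 ≤ p.kE ∧ p.kP - p.ka1 ≤ p.kE ∧ p.th1 < 1 ∧ 1 < p.kT ∧ 1 < p.k56 ∧ p.bmax < p.r58hi

/-- Rows of §8 [II-L8.1a, X-II.L8.1b, II-8.07a, II-L8.2a, X-II.L5.8a (producer side, minus the
`A`-row), II-L8.3a, II-L8.4a (minus the `A`-row), II-8.09a/b, II-8.11a, II-8.12a, II-8.23a]:
Lemma 8.1 (`k52 = k0 − k1 + kP`, `k52 − 5kP > kPfrak`: the THINNEST margin of Part II, one power of
`𝓛`); supports (8.7); Lemma 8.2 (`1 < kT`, the circle `rad ± bmax` inside `[r58lo, r58hi]`,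
`k82 = ka2 − kP`); Lemma 5.8's Taylor budget `ka2 ≤ 2kP − 3`; Lemma 8.3 (`k84 ≤ k83 − 2`,
`sig83 < 1`); Lemma 8.4 (Lemma 5.5's box covers the rectangle: `cL < zfrW`, `cH ≤ zfrH`; inversion
`kP < ka2`; `k84 ≤ ka2 − kP`); boundary windows `kT < kP`; `λ₀ⱼ`'s `O(α₁)`: `4 < ka1`; (8.11) error
budget `2 < k82`, `2 < k84`; (8.12) `kff = kP − 1 > 0`; (8.23) `kE < kP`.
[cite: Zhang2022LandauSiegel, §8] -/
def SectionEight (p : PartIIDesign) : Prop :=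
  p.k52 = p.k0 - p.k1 + p.kP ∧ p.kPfrak < p.k52 - 5 * p.kP ∧ p.th2 < 1 ∧
  p.r58lo ≤ p.rad - p.bmax ∧ p.rad + p.bmax ≤ p.r58hi ∧ p.k82 = p.ka2 - p.kP ∧
  p.ka2 ≤ 2 * p.kP - 3 ∧ p.k84 ≤ p.k83 - 2 ∧ p.sig83 < 1 ∧ p.cL < p.zfrW ∧ p.cH ≤ p.zfrH ∧
  p.kP < p.ka2 ∧ p.k84 ≤ p.ka2 - p.kP ∧ p.kT < p.kP ∧ 4 < p.ka1 ∧ 2 < p.k82 ∧ 2 < p.k84 ∧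
  p.kff = p.kP - 1 ∧ 0 < p.kff ∧ p.kE < p.kP

/-- Rows of §§9–12 [II-9.01b, II-9.07a, II-10.01b, II-10.02a, II-10.03a, II-10.08a (load-bearing
part), II-11.02a, II-11.03a, II-11.04a/c, II-12.01a, II-12.06a, II-12.09a]: supports of `a₁₂`
(`th3 < th2 < 1`), of `a₁₃, a₁₄` (`z2 < 1`, `z2 − dJ < 1`); (10.2) Pólya–Vinogradov above `T`
(`1 < kT`); window terms (10.5)/(10.11) `2 + kT < k105`; Lemma 11.1 (`keps ≤ 2(kg − keta)`,
`k113 < keta + kP`); the window mean square `kP < 2k113 + keta`; Lemma 11.2: tent symmetry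
`z1 − z0 = z2 − z1`, `dJ = z2 − z0`, `slope·(z1 − z0) = 1`, `ω₁`-tail `keps ≤ 2kv − kg1`, and
`Σc*|E₂|²ω`: `kg1 + 4kP < 2kE2`; (12.1)–(12.2): `th14 + th3 < 1`, `th14 + th2 ≤ 1` with `gS ≤ gT2`;
(12.6) window `kP < k126` (second-thinnest margin, one power of `𝓛`).
[cite: Zhang2022LandauSiegel, §§9–12] -/
def SectionsNineToTwelve (p : PartIIDesign) : Prop :=
  p.th3 < p.th2 ∧ p.th3 < 1 ∧ p.z2 < 1 ∧ p.z2 - p.dJ < 1 ∧ 2 + p.kT < p.k105 ∧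
  p.keps ≤ 2 * (p.kg - p.keta) ∧ p.k113 < p.keta + p.kP ∧ p.kP < 2 * p.k113 + p.keta ∧
  p.z1 - p.z0 = p.z2 - p.z1 ∧ p.dJ = p.z2 - p.z0 ∧ p.slope * (p.z1 - p.z0) = 1 ∧
  p.keps ≤ 2 * p.kv - p.kg1 ∧ p.kg1 + 4 * p.kP < 2 * p.kE2 ∧
  p.th14 + p.th3 < 1 ∧ p.th14 + p.th2 ≤ 1 ∧ p.gS ≤ p.gT2 ∧ p.kP < p.k126 ∧ p.kE < p.kP

/-- `AdmissibleII p`: the conjunction of every Part II row of the cell's census (§§7–12 and the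
consumer side of the Part-I inputs), i.e. the parameter conditions under which the manuscript's
§§7–12 bookkeeping goes through as written (given its analytic lemmas, which are NOT asserted).
[cite: Zhang2022LandauSiegel, §§7–12] -/
def AdmissibleII (p : PartIIDesign) : Prop :=
  p.ABinding ∧ p.SectionSeven ∧ p.SectionEight ∧ p.SectionsNineToTwelve

/-- The printed design satisfies the two `A`-rows (`15 ≤ 2022`, `9 < 2022`). [folklore] -/
theorem printedII_aBinding : printedII.ABinding := by
  norm_num [ABinding, printedII]

/-- The printed design satisfies the §7 rows (e.g. `3·68 + 57·9 = 717 < 739`, `1 < 1.1`). [folklore] -/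
theorem printedII_sectionSeven : printedII.SectionSeven := by
  norm_num [SectionSeven, printedII]

/-- The printed design satisfies the §8 rows (e.g. `123 = 519 − 405 + 9`, `77 < 123 − 45`, `5 ± 3 ∈ [1, 10]`). [folklore] -/
theorem printedII_sectionEight : printedII.SectionEight := by
  norm_num [SectionEight, printedII]

/-- The printed design satisfies the §§9–12 rows (e.g. `0.502 − 0.5 = 0.504 − 0.502`, `500·0.002 = 1`, `0.5 + 0.498 < 1`). [folklore] -/
theorem printedII_sectionsNineToTwelve : printedII.SectionsNineToTwelve := by
  norm_num [SectionsNineToTwelve, printedII]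

/-- The printed design satisfies every inventoried Part II row: the exponent / support bookkeeping
of §§7–12 is internally consistent as printed. Decidable arithmetic on literals. [folklore] -/
theorem printedII_admissible : printedII.AdmissibleII :=
  ⟨printedII_aBinding, printedII_sectionSeven, printedII_sectionEight, printedII_sectionsNineToTwelve⟩

/-- The one Part II row violated AS PRINTED [T-II.E20b, cell errata E-II-g20-2]: on the circle
`|s| = rad2·α = 10α` of Lemma 10.2 the arguments `1 + s + β_j` reach `|· − 1| = (rad2 + bmax)α = 13α`,
outside Lemma 5.8's printed annulus `|s − 1| ≤ r58hi·α = 10α`. Immaterial (Lemma 5.8 holds on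
`[α, Cα]` for any fixed `C` with `O_C(α₂)`), hence not a conjunct of `AdmissibleII`; recorded as the
arithmetic fact `¬ (10 + 3 ≤ 10)` on the printed design. [folklore] -/
theorem printedII_radius102_violated : ¬ (printedII.rad2 + printedII.bmax ≤ printedII.r58hi) := by
  norm_num [printedII]

/-- With every other parameter as printed, Part II's rows are admissible iff `15 ≤ A`: the
(A)-exponent enters §§7–12 only through `α₂ = 𝓛^{-15} ≥ 𝓛^{-A}` (Lemma 5.8) and `1 − ρ̃ < 5α`
(Lemma 5.5 in Lemma 8.4). Part II does not bind `A = 2022`. [folklore] -/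
theorem admissible_withA_iff (a : ℝ) : ({ printedII with A0 := a } : PartIIDesign).AdmissibleII ↔ 15 ≤ a := by
  constructor
  · rintro ⟨⟨h, -⟩, -⟩
    norm_num [printedII] at h
    exact h
  · intro ha
    refine ⟨⟨?_, ?_⟩, ?_, ?_, ?_⟩
    · norm_num [printedII]; exact ha
    · norm_num [printedII]; linarith
    · norm_num [SectionSeven, printedII]
    · norm_num [SectionEight, printedII]
    · norm_num [SectionsNineToTwelve, printedII]

end PartIIDesign

/-! ### The numerical face of Part II

The printed numerical closing conditions PRODUCED in Part II (their main terms are Part II's; the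
constants are `D → ∞` limits independent of every field of `PartIIDesign`): (8.24) `𝔠₁ < 6.9955`
(`Ineq824`); (9.8) `𝔠₂ < 6.9955` (consistent-prefactor reading `Ineq98c`; the printed-prefactor
reading `Ineq98` is also certified); §10 [p. 22]: `Re 𝔡′ > −(8/(0.498π))Re ι₃ − 0.04 > 5.1`
(`Ineq10a`, `Ineq10b`), `|Re 𝔡| < 0.1` (`Ineq10c`), and Prop. 2.4's `|𝔡′ + 𝔡| > 5` (`Prop24Main`);
(2.33)'s `C₂₃₃ < 3000` (`Ineq233`; main terms from Lemmas 10.1/10.2, App. B). No new named `Prop` is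
minted for their conjunction (it would be an undischargeable debt: it is false); the two theorems
below state its status directly. -/

/-- Every printed numerical closing condition of Part II other than (8.24) is certified TRUE
(cell NUMERICS rows 14, 21–23, 35; kernel certificates `Section18Certificate.ineq98c`,
`Section10Certificate.Ineq10a_holds` … `Ineq233_holds`). [folklore] -/
theorem numericClosingPartII_except824 :
    Ineq98c ∧ Ineq10a ∧ Ineq10b ∧ Ineq10c ∧ Prop24Main ∧ Ineq233 :=
  ⟨ineq98c, Ineq10a_holds, Ineq10b_holds, Ineq10c_holds, Prop24Main_holds, Ineq233_holds⟩

/-- … and (8.24) is certified FALSE (`𝔠₁ = 7.05010…`, `Section8Certificate.not_ineq824`), so the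
conjunction fails. This is the cell's GAP (row N-II.8.24a), restated. [folklore] -/
theorem not_numericClosingPartII :
    ¬ (Ineq824 ∧ Ineq98c ∧ Ineq10a ∧ Ineq10b ∧ Ineq10c ∧ Prop24Main ∧ Ineq233) :=
  fun h => not_ineq824 h.1

/-- The SHAPE of the manuscript's Part II deliverable restricted to its numerical face —
"admissible design ⇒ the printed numerical closing conditions" — FAILS at the printed design: the
design is admissible (`printedII_admissible`) and (8.24) is false (`not_numericClosingPartII`). No
admissible re-choice of the exponents changes this, since the conjunction `Ineq824 ∧ … ∧ Ineq233`
does not mention them. The analytic face (the asymptotic formulae (8.23), (9.7), (10.17), (12.9)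
with `o(𝔞𝔓)` errors) is not formalised and nothing is said about it. [folklore] -/
theorem PartIIDesign.not_claimedNumericFace_printedII :
    ¬ (PartIIDesign.printedII.AdmissibleII →
        Ineq824 ∧ Ineq98c ∧ Ineq10a ∧ Ineq10b ∧ Ineq10c ∧ Prop24Main ∧ Ineq233) :=
  fun h => not_numericClosingPartII (h PartIIDesign.printedII_admissible)

end Literature.NumberTheory.LFunctions.Zhang2022
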